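import Summits.CriticalPhenomena.PercolationContinuityZ3.Theorems.Transplant.StarBoundaryGen
import Summits.CriticalPhenomena.PercolationContinuityZ3.Theorems.Transplant.StarRetractRegions
import HarnessLib

/-!
# THE CONTOUR LEMMA IN A TRUNCATED HORN: a good `★`-cluster that dies before the far face is blocked by a LARGE bad `★`-animal

builds on p205010 (kernel theorem, internal audit signed; external expert review pending) — NOT used in this file.
Lane `prim-bschramm`, seat `prim-bschramm-p2` (gen 25; class C1b; memo `HOME/bschramm/P2-LATTICES.md` §90, the HORN PROGRAMME, file P1);
helper file (`--supports stmt-CriticalPhenomena-4575 --as helper`).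

Deterministic core of the Peierls argument for percolation in 3D horns at the true threshold `f²/log → ∞`.  Sites of `ℤ³` are good or bad;
`V = hornRegion a b F₀ F₂` is the truncated coarse horn (axis = coordinate `1`, admissible profiles); `l₀ ∈ V` is a GOOD seed at level `a`
whose good `★`-cluster inside `V` does not reach the far face `{z₁ = b}`.  **`exists_contour`**: there are a `★`-connected set `Y ⊆ V` of
BAD sites and levels `a ≤ t ≤ s ≤ b` such that
  (1) `Y ∋ (l₀)₀ e₀ + s e₁ + (l₀)₂ e₂` — `Y` meets the axis column through the seed at level `s`;
  (2) every point of `Y` has level `≥ t`, and `#Y ≥ s − t + 1`;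
  (3) if `t > a` then `#Y ≥ (F₀(t−1)+1)(F₂(t−1)+1)` — `Y` covers, in projection, the full cross-section at level `t − 1`.
Mechanism: `A` = good cluster of `l₀`; `Ω` = `★`-component of `V ∖ A` containing the far face; `Y = {x ∈ Ω | x ★-adjacent to A}` is
`★`-connected by Lemma B.82 relative to `V` in components form (`StarRetract.starConn_contact_of_starComponent`, with B.81 for the horn from
its `1`-Lipschitz retraction, `gen_hornRegion`), consists of bad sites (a good neighbour of `A` in `V` belongs to `A`), the sub-horn below
the lowest level `t` of `Y` misses `Ω` (it is `★`-connected and contains `l₀`), so every axis-parallel column over the cross-section at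
level `t − 1` enters `Ω` through a point of `Y`; a `★`-chain inside `Y` from level `t` to level `s` visits every level in between.
[cite: FriedliVelenik2017, App. B.15, Lemma B.82; §7.2.6] [cite: DeuschelPisztora1996, Lemma 2.1 (ii) (p. 471)] [cite: GrimmettPercolation1999, §1.4 p. 16 (Peierls argument)]
-/

open Finset SimpleGraph Relation
open Literature.Combinatorics.SimpleGraph.CycleSpace Literature.Probability.LatticeModels

namespace Summit.CriticalPhenomena.PercolationContinuityZ3.Theorems.Transplant

namespace HornContour

open StarRetract

/-! ## §1 Two elementary chain lemmas -/

/-- **Leaving a set along a chain**: a chain from a point with property `P` to a point without it contains a step from `P` to `¬P`.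
[folklore] -/
theorem exists_step_out {α : Type*} {R : α → α → Prop} {P : α → Prop} {x y : α} (h : ReflTransGen R x y) (hx : P x)
    (hy : ¬ P y) : ∃ c c', R c c' ∧ P c ∧ ¬ P c' := by
  induction h with
  | refl => exact absurd hx hy
  | @tail b c _ hbc ih =>
    by_cases hb : P b
    · exact ⟨b, c, hbc, hb, hy⟩
    · exact ih hb

/-- **First entrance along a sequence**: if `P` fails at `q 0` and holds at `q N`, there is an index `1 ≤ j ≤ N` with `P (q j)` and
`¬ P (q (j - 1))`. [folklore] -/
theorem exists_first_index {β : Type*} (q : ℕ → β) (P : β → Prop) {N : ℕ} (h0 : ¬ P (q 0)) (hN : P (q N)) :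
    ∃ j, 1 ≤ j ∧ j ≤ N ∧ P (q j) ∧ ¬ P (q (j - 1)) := by
  classical
  have hex : ∃ j, P (q j) := ⟨N, hN⟩
  refine ⟨Nat.find hex, ?_, Nat.find_min' hex hN, Nat.find_spec hex, ?_⟩
  · rcases Nat.eq_zero_or_pos (Nat.find hex) with h | h
    · exact absurd (h ▸ Nat.find_spec hex) h0
    · exact h
  · refine Nat.find_min hex ?_
    have : 0 < Nat.find hex := by
      rcases Nat.eq_zero_or_pos (Nat.find hex) with h | h
      · exact absurd (h ▸ Nat.find_spec hex) h0
      · exact h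
    omega

/-- Coordinates of `![u, s, v]`. [folklore] -/
theorem vec3_apply (u s v : ℤ) : (![u, s, v] : Site 3) 0 = u ∧ (![u, s, v] : Site 3) 1 = s ∧ (![u, s, v] : Site 3) 2 = v := by
  simp

/-! ## §2 The contour lemma -/

/-- **THE CONTOUR LEMMA IN A TRUNCATED HORN.**  `V = hornRegion a b F₀ F₂` with admissible profiles, `good : ℤ³ → Prop`, a good seed
`l₀ ∈ V` at level `a` whose good `★`-cluster in `V` stays strictly below level `b`.  Then there are a finite `★`-connected set `Y` of bad
sites of `V` and levels `a ≤ t ≤ s ≤ b` with `(l₀ 0, s, l₀ 2) ∈ Y`, all levels of `Y` at least `t`, `#Y ≥ s − t + 1`, and, if `t > a`,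
`#Y ≥ (F₀(t−1)+1)(F₂(t−1)+1)` (as a product of `toNat`s). [cite: FriedliVelenik2017, App. B.15, Lemma B.82; §7.2.6] [cite: DeuschelPisztora1996, Lemma 2.1 (ii) (p. 471)] -/
theorem exists_contour {a b : ℤ} {F₀ F₂ : ℤ → ℤ} (h₀ : HornProfile a b F₀) (h₂ : HornProfile a b F₂)
    (good : Site 3 → Prop) {l₀ : Site 3} (hl₀ : l₀ ∈ hornRegion a b F₀ F₂) (hl₀a : l₀ 1 = a) (hgood : good l₀)
    (hmiss : ∀ z, ReflTransGen (starRel {w | w ∈ hornRegion a b F₀ F₂ ∧ good w}) l₀ z → z 1 < b) :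
    ∃ (Y : Finset (Site 3)) (t s : ℤ), StarConn (Y : Set (Site 3)) ∧ (∀ y ∈ Y, y ∈ hornRegion a b F₀ F₂ ∧ ¬ good y) ∧
      a ≤ t ∧ t ≤ s ∧ s ≤ b ∧ (![l₀ 0, s, l₀ 2] : Site 3) ∈ Y ∧ (∀ y ∈ Y, t ≤ y 1) ∧ (s - t + 1).toNat ≤ Y.card ∧
      (a < t → (F₀ (t - 1) + 1).toNat * (F₂ (t - 1) + 1).toNat ≤ Y.card) := by
  classical
  set V : Set (Site 3) := hornRegion a b F₀ F₂ with hV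
  have hab : a < b := by have := hmiss l₀ ReflTransGen.refl; rwa [hl₀a] at this
  have hVfin : V.Finite := hornRegion_finite h₀ h₂
  have hVconn : StarConn V := starConn_hornRegion hab.le h₀ h₂
  -- the good cluster `A` of the seed
  set A : Set (Site 3) := {z | ReflTransGen (starRel {w | w ∈ V ∧ good w}) l₀ z} with hA
  have hl₀A : l₀ ∈ A := ReflTransGen.refl
  have hAmem : ∀ z ∈ A, z ∈ V ∧ good z := fun z hz => mem_of_reflTransGen_starRel hz ⟨hl₀, hgood⟩
  have hAV : A ⊆ V := fun z hz => (hAmem z hz).1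
  have hAfin : A.Finite := hVfin.subset hAV
  have hAclosed : ∀ x ∈ A, ∀ y, starRel {w | w ∈ V ∧ good w} x y → y ∈ A := fun x hx y hxy => ReflTransGen.tail hx hxy
  have hAconn : StarConn A := by
    intro x hx y hy
    have h1 : ReflTransGen (starRel A) l₀ x := reflTransGen_starRel_restrict hAclosed hl₀A hx
    have h2 : ReflTransGen (starRel A) l₀ y := reflTransGen_starRel_restrict hAclosed hl₀A hy
    exact (reflTransGen_starRel_symm h1).trans h2
  -- a good point of `V` adjacent to `A` lies in `A`
  have hAgrow : ∀ x ∈ A, ∀ y ∈ V, good y → (zdStar 3).Adj x y → y ∈ A :=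
    fun x hx y hyV hy hadj => hAclosed x hx y ⟨hadj, hAmem x hx, ⟨hyV, hy⟩⟩
  -- the far face and the outer component `Ω`
  set r₀ : Site 3 := ![0, b, 0] with hr₀
  have hr₀V : r₀ ∈ V := face_point_mem hab.le h₀ h₂
  have hface : ∀ z ∈ V, z 1 = b → z ∉ A := fun z _ hzb hzA => by have := hmiss z hzA; omega
  set Ω : Set (Site 3) := {z | ReflTransGen (starRel (V \ A)) r₀ z} with hΩ
  have hr₀Ω : r₀ ∈ Ω := ReflTransGen.refl
  have hr₀A : r₀ ∉ A := hface r₀ hr₀V (by simp [hr₀])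
  have hΩmem : ∀ z ∈ Ω, z ∈ V ∧ z ∉ A := fun z hz => mem_of_reflTransGen_starRel hz ⟨hr₀V, hr₀A⟩
  have hΩclosed : ∀ x ∈ Ω, ∀ y, starRel (V \ A) x y → y ∈ Ω := fun x hx y hxy => ReflTransGen.tail hx hxy
  have hΩmax : ∀ y ∈ V, y ∉ A → ∀ x ∈ Ω, (zdStar 3).Adj x y → y ∈ Ω :=
    fun y hyV hyA x hx hadj => hΩclosed x hx y ⟨hadj, hΩmem x hx, ⟨hyV, hyA⟩⟩
  have hΩconn : StarConn Ω := by
    intro x hx y hy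
    have h1 : ReflTransGen (starRel Ω) r₀ x := reflTransGen_starRel_restrict hΩclosed hr₀Ω hx
    have h2 : ReflTransGen (starRel Ω) r₀ y := reflTransGen_starRel_restrict hΩclosed hr₀Ω hy
    exact (reflTransGen_starRel_symm h1).trans h2
  have hΩfin : Ω.Finite := hVfin.subset fun z hz => (hΩmem z hz).1
  -- the whole far face lies in `Ω`
  have hfaceΩ : ∀ z ∈ V, z 1 = b → z ∈ Ω := by
    intro z hzV hzb
    have hconn := starConn_face (F₀ := F₀) (F₂ := F₂) hab.le r₀ ⟨hr₀V, by simp [hr₀]⟩ z ⟨hzV, hzb⟩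
    exact reflTransGen_starRel_mono (S := {z : Site 3 | z ∈ V ∧ z 1 = b}) (T := V \ A)
      (fun w hw => ⟨hw.1, hface w hw.1 hw.2⟩) hconn
  -- a point of `V` outside `Ω` that is `★`-adjacent to `Ω` lies in `A`
  have hstepA : ∀ x ∈ Ω, ∀ y ∈ V, y ∉ Ω → (zdStar 3).Adj x y → y ∈ A := by
    intro x hx y hyV hyΩ hadj
    by_contra hyA
    exact hyΩ (hΩmax y hyV hyA x hx hadj)
  -- the contact set `Y`
  set Af : Finset (Site 3) := hAfin.toFinset with hAf
  set Ωf : Finset (Site 3) := hΩfin.toFinset with hΩf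
  have hAf_mem : ∀ z, z ∈ Af ↔ z ∈ A := fun z => Set.Finite.mem_toFinset _
  have hΩf_mem : ∀ z, z ∈ Ωf ↔ z ∈ Ω := fun z => Set.Finite.mem_toFinset _
  have hAf_coe : (Af : Set (Site 3)) = A := Set.Finite.coe_toFinset _
  have hΩf_coe : (Ωf : Set (Site 3)) = Ω := Set.Finite.coe_toFinset _
  have hYconn : StarConn {x | x ∈ Ωf ∧ ∃ y ∈ Af, (zdStar 3).Adj x y} := by
    refine starConn_contact_of_starComponent hVconn (gen_hornRegion hab.le h₀ h₂)
      (fun z hz => hAV ((hAf_mem z).1 hz)) (by rw [hAf_coe]; exact hAconn)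
      (fun z hz => (hΩmem z ((hΩf_mem z).1 hz)).1) ?_ (by rw [hΩf_coe]; exact hΩconn) ?_
    · rw [Finset.disjoint_left]
      intro z hzΩ hzA
      exact (hΩmem z ((hΩf_mem z).1 hzΩ)).2 ((hAf_mem z).1 hzA)
    · intro y hyV hyA x hxΩ hadj
      exact (hΩf_mem y).2 (hΩmax y hyV (fun h => hyA ((hAf_mem y).2 h)) x ((hΩf_mem x).1 hxΩ) hadj)
  set Yf : Finset (Site 3) := Ωf.filter fun x => ∃ y ∈ Af, (zdStar 3).Adj x y with hYf
  have hYf_mem : ∀ x, x ∈ Yf ↔ x ∈ Ω ∧ ∃ y ∈ A, (zdStar 3).Adj x y := by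
    intro x
    rw [hYf, Finset.mem_filter, hΩf_mem]
    constructor
    · rintro ⟨hx, y, hy, hadj⟩; exact ⟨hx, y, (hAf_mem y).1 hy, hadj⟩
    · rintro ⟨hx, y, hy, hadj⟩; exact ⟨hx, y, (hAf_mem y).2 hy, hadj⟩
  have hYf_coe : (Yf : Set (Site 3)) = {x | x ∈ Ωf ∧ ∃ y ∈ Af, (zdStar 3).Adj x y} := by
    ext x; simp only [Finset.mem_coe, hYf, Finset.mem_filter, Set.mem_setOf_eq]
  have hYstar : StarConn (Yf : Set (Site 3)) := by rw [hYf_coe]; exact hYconn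
  -- `Y` consists of bad sites of `V`
  have hYbad : ∀ y ∈ Yf, y ∈ V ∧ ¬ good y := by
    intro y hy
    obtain ⟨hyΩ, x, hxA, hadj⟩ := (hYf_mem y).1 hy
    refine ⟨(hΩmem y hyΩ).1, fun hg => (hΩmem y hyΩ).2 (hAgrow x hxA y (hΩmem y hyΩ).1 hg hadj.symm)⟩
  -- entering `Ω` from outside along a `★`-step produces a point of `Y`
  have henter : ∀ x y, x ∈ V → x ∉ Ω → y ∈ Ω → (zdStar 3).Adj x y → y ∈ Yf :=
    fun x y hxV hxΩ hyΩ hadj => (hYf_mem y).2 ⟨hyΩ, x, hstepA y hyΩ x hxV hxΩ hadj.symm, hadj.symm⟩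
  -- the axis column through the seed: `q j = (l₀ 0, a + j, l₀ 2)`
  set q : ℕ → Site 3 := fun j => ![l₀ 0, a + j, l₀ 2] with hq
  have hqV : ∀ j : ℕ, a + j ≤ b → q j ∈ V := fun j hj =>
    column_mem h₀ h₂ le_rfl hl₀.2.2.1 (by rw [← hl₀a]; exact hl₀.2.2.2.1) hl₀.2.2.2.2.1
      (by rw [← hl₀a]; exact hl₀.2.2.2.2.2) (by omega) hj
  have hq0 : q 0 = l₀ := by
    funext i; fin_cases i
    · simp [hq]
    · show (![l₀ 0, a + ((0 : ℕ) : ℤ), l₀ 2] : Site 3) 1 = l₀ 1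
      simp [hl₀a]
    · simp [hq]
  set N : ℕ := (b - a).toNat with hN
  have hNb : a + (N : ℤ) = b := by rw [hN, Int.toNat_of_nonneg (by omega)]; ring
  have hqN : q N ∈ Ω := hfaceΩ (q N) (hqV N hNb.le) (by simp [hq, hNb])
  have hq0Ω : q 0 ∉ Ω := by rw [hq0]; exact fun h => (hΩmem l₀ h).2 hl₀A
  obtain ⟨j, hj1, hjN, hjΩ, hjΩ'⟩ := exists_first_index q (· ∈ Ω) hq0Ω hqN
  have hjadj : (zdStar 3).Adj (q (j - 1)) (q j) := by
    have e : (a + ((j - 1 : ℕ) : ℤ)) + 1 = a + (j : ℤ) := by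
      rw [Nat.cast_sub hj1]; push_cast; ring
    have := column_adj (l₀ 0) (l₀ 2) (a + ((j - 1 : ℕ) : ℤ))
    rwa [e] at this
  have hqjY : q j ∈ Yf := henter (q (j - 1)) (q j) (hqV (j - 1) (by omega)) hjΩ' hjΩ hjadj
  -- the anchor level `s` and the lowest level `t` of `Y`
  set s : ℤ := a + j with hs
  have hYne : Yf.Nonempty := ⟨q j, hqjY⟩
  set t : ℤ := Yf.inf' hYne fun y => y 1 with ht
  have htle : ∀ y ∈ Yf, t ≤ y 1 := fun y hy => Finset.inf'_le _ hy
  obtain ⟨yt, hytY, hyt⟩ := Finset.exists_mem_eq_inf' hYne fun y => y 1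
  have hyt' : t = yt 1 := by rw [ht]; exact hyt
  have hta : a ≤ t := by rw [hyt']; exact (hYbad yt hytY).1.1
  have hts : t ≤ s := by have := htle _ hqjY; simpa [hq] using this
  have hsb : s ≤ b := by rw [hs]; omega
  have hanchor : (![l₀ 0, s, l₀ 2] : Site 3) ∈ Yf := by simpa [hq, hs] using hqjY
  -- (2) `#Y ≥ s - t + 1`: a chain inside `Y` from `yt` (level `t`) to the anchor (level `s`) visits every level
  have hlevels : ∀ ℓ, t ≤ ℓ → ℓ ≤ s → ∃ z ∈ Yf, z 1 = ℓ := by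
    intro ℓ h1 h2
    have hchain := hYstar yt (Finset.mem_coe.2 hytY) _ (Finset.mem_coe.2 hanchor)
    obtain ⟨z, hz, hzℓ⟩ := exists_level_of_reflTransGen hchain (ℓ := ℓ) (by rw [← hyt']; exact h1) (by simpa using h2)
    rcases hz with rfl | hz
    · exact ⟨_, hytY, hzℓ⟩
    · exact ⟨z, Finset.mem_coe.1 hz, hzℓ⟩
  have hcard1 : (s - t + 1).toNat ≤ Yf.card := by
    choose! z hz hz1 using hlevels
    have hinj : Set.InjOn (fun i : ℕ => z (t + i)) (Finset.range (s - t + 1).toNat : Set ℕ) := by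
      intro i hi i' hi' h
      have e1 := hz1 (t + i) (by omega) (by
        have := Finset.mem_range.1 (Finset.mem_coe.1 hi); omega)
      have e2 := hz1 (t + i') (by omega) (by
        have := Finset.mem_range.1 (Finset.mem_coe.1 hi'); omega)
      have h' : z (t + i) = z (t + i') := h
      have : (z (t + i)) 1 = (z (t + i')) 1 := by rw [h']
      rw [e1, e2] at this
      omega
    calc (s - t + 1).toNat = (Finset.range (s - t + 1).toNat).card := (Finset.card_range _).symm
      _ ≤ Yf.card := Finset.card_le_card_of_injOn (fun i => z (t + i)) (fun i hi => hz (t + i) (by omega) (by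
          have := Finset.mem_range.1 hi; omega)) hinj
  -- (3) if `t > a`: the sub-horn below level `t` misses `Ω`, and every column over the cross-section at level `t - 1` enters `Ω` in `Y`
  have hcard2 : a < t → (F₀ (t - 1) + 1).toNat * (F₂ (t - 1) + 1).toNat ≤ Yf.card := by
    intro hat
    -- the sub-horn `hornRegion a (t-1)` misses `Ω`
    have hbelow : ∀ z ∈ V, z 1 < t → z ∉ Ω := by
      intro z hzV hzt hzΩ
      have hsub : StarConn (hornRegion a (t - 1) F₀ F₂) :=
        starConn_hornRegion (by omega) (h₀.mono_right (by omega)) (h₂.mono_right (by omega))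
      have hchain := hsub z (mem_hornRegion_of_level_le hzV (by omega)) l₀ (mem_hornRegion_of_level_le hl₀ (by omega))
      obtain ⟨c, c', hcc', hc, hc'⟩ := exists_step_out (P := (· ∈ Ω)) hchain hzΩ (fun h => (hΩmem l₀ h).2 hl₀A)
      -- `c ∈ Ω`, `c' ∉ Ω`, both in the sub-horn: then `c ∈ Y` at level `< t`
      have hc'V : c' ∈ V := hornRegion_mono (by omega) hcc'.2.2
      have hcY : c ∈ Yf := (hYf_mem c).2 ⟨hc, c', hstepA c hc c' hc'V hc' hcc'.1, hcc'.1⟩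
      have := htle c hcY
      have hclev : c 1 ≤ t - 1 := hcc'.2.1.2.1
      omega
    -- columns over the rectangle `[0, F₀(t-1)] × [0, F₂(t-1)]`
    have hcol : ∀ u v : ℤ, 0 ≤ u → u ≤ F₀ (t - 1) → 0 ≤ v → v ≤ F₂ (t - 1) →
        ∃ y ∈ Yf, y 0 = u ∧ y 2 = v := by
      intro u v hu huF hv hvF
      set c : ℕ → Site 3 := fun i => ![u, (t - 1) + i, v] with hc
      have hcV : ∀ i : ℕ, t - 1 + i ≤ b → c i ∈ V := fun i hi =>
        column_mem h₀ h₂ (by omega) hu huF hv hvF (by omega) hi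
      set M : ℕ := (b - (t - 1)).toNat with hM
      have hMb : t - 1 + (M : ℤ) = b := by rw [hM, Int.toNat_of_nonneg (by omega)]; ring
      have hcM : c M ∈ Ω := hfaceΩ (c M) (hcV M hMb.le) (by simp [hc, hMb])
      have hc0 : c 0 ∉ Ω := hbelow (c 0) (hcV 0 (by push_cast; omega)) (by simp [hc])
      obtain ⟨i, hi1, hiM, hiΩ, hiΩ'⟩ := exists_first_index c (· ∈ Ω) hc0 hcM
      have hiadj : (zdStar 3).Adj (c (i - 1)) (c i) := by
        have e : (t - 1 + ((i - 1 : ℕ) : ℤ)) + 1 = t - 1 + (i : ℤ) := by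
          rw [Nat.cast_sub hi1]; push_cast; ring
        have := column_adj u v (t - 1 + ((i - 1 : ℕ) : ℤ))
        rwa [e] at this
      refine ⟨c i, henter (c (i - 1)) (c i) (hcV (i - 1) (by omega)) hiΩ' hiΩ hiadj, ?_, ?_⟩
      · simp [hc]
      · simp [hc]
    choose! y hyY hy0 hy2 using hcol
    have hF0 : 0 ≤ F₀ (t - 1) := h₀.nonneg _ (by omega) (by omega)
    have hF2 : 0 ≤ F₂ (t - 1) := h₂.nonneg _ (by omega) (by omega)
    set R : Finset (ℤ × ℤ) := Finset.Icc (0 : ℤ) (F₀ (t - 1)) ×ˢ Finset.Icc (0 : ℤ) (F₂ (t - 1)) with hR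
    have hRcard : R.card = (F₀ (t - 1) + 1).toNat * (F₂ (t - 1) + 1).toNat := by
      rw [hR, Finset.card_product, Int.card_Icc, Int.card_Icc, sub_zero, sub_zero]
    have hinj : Set.InjOn (fun w : ℤ × ℤ => y w.1 w.2) (R : Set (ℤ × ℤ)) := by
      intro w hw w' hw' h
      have hw1 := Finset.mem_product.1 (Finset.mem_coe.1 hw)
      have hw1' := Finset.mem_product.1 (Finset.mem_coe.1 hw')
      have a1 := Finset.mem_Icc.1 hw1.1; have a2 := Finset.mem_Icc.1 hw1.2
      have b1 := Finset.mem_Icc.1 hw1'.1; have b2 := Finset.mem_Icc.1 hw1'.2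
      have h' : y w.1 w.2 = y w'.1 w'.2 := h
      have e0 : (y w.1 w.2) 0 = (y w'.1 w'.2) 0 := by rw [h']
      have e2 : (y w.1 w.2) 2 = (y w'.1 w'.2) 2 := by rw [h']
      rw [hy0 _ _ a1.1 a1.2 a2.1 a2.2, hy0 _ _ b1.1 b1.2 b2.1 b2.2] at e0
      rw [hy2 _ _ a1.1 a1.2 a2.1 a2.2, hy2 _ _ b1.1 b1.2 b2.1 b2.2] at e2
      exact Prod.ext e0 e2
    rw [← hRcard]
    exact Finset.card_le_card_of_injOn (fun w => y w.1 w.2) (fun w hw => by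
      have hw1 := Finset.mem_product.1 hw
      have a1 := Finset.mem_Icc.1 hw1.1; have a2 := Finset.mem_Icc.1 hw1.2
      exact hyY _ _ a1.1 a1.2 a2.1 a2.2) hinj
  exact ⟨Yf, t, s, hYstar, hYbad, hta, hts, hsb, hanchor, htle, hcard1, hcard2⟩

end HornContour

end Summit.CriticalPhenomena.PercolationContinuityZ3.Theorems.Transplant
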